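import Literature.IUT.HodgeTheaters.InitialThetaDataCuspNormaliserLaw
import Literature.IUT.HodgeTheaters.PuncturedEllipticCoveringsCuspsProofs
import Literature.IUT.HodgeTheaters.PiAvatarToFlStar
import HarnessLib

/-!
# Equivariance of the derived cusp action `actF` (G-L5t4g3-3) with respect to t1's `CG.act`:
# `n·(g·x) = (n g n⁻¹)·(n·x)` — the first input of the kit law `gLabMap_autPM` at the genuine `𝒟^{⊚±}` (proof-only)

S. Mochizuki, *Inter-universal Teichmüller theory I*, kurims manuscript (May 2020), Def 6.1 (v) p. 158 («`Aut(𝒟^{⊚±})` acts on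
`LabCusp^±(𝒟^{⊚±})` … compatibly with the `𝔽_l^±`-torsor structure») ([IUTchI] Def 6.1 (v) p.158) [claim: Mochizuki2012, status: disputed]
(D-0012 claim key, series status DISPUTED — kernel theorems over abc-iut-L5-t2's REAL `InitialThetaData` and abc-iut-L5-t1's
`CuspGalois`, under the hypothesis binder `hS : D.CuspClassesNormaliserStable`; nothing of the series is asserted, no side is taken
on [IUTchIII] Cor. 3.12).

`conj_embK_mem_PiXund` (`Π_{X̲_K} ⊴ Π_{C_K}`: t1's `normal_PiXbar` along `embK`), and **`actF_act`**: for `n ∈ N(Π_{X̲_K})`,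
`g, g′ ∈ Π_{C_K}` with `embK g′ = n·embK g·n⁻¹`, and every cusp `x`: `actF n (CG.act g x) = CG.act g′ (actF n x)` — i.e. the
bijection `actF n` of `Cusp(X̲_K)` intertwines the `Π_{C_K}`-action with its `n`-conjugate; with `g ∈ Π_X` this says `actF n` is
AFFINE for the group law of the cusps (translation part `labChart_act_of_mem_PiX`, linear part = d065's `conjExponent`), the
content of the kit law `gLabMap_autPM` (next t4 file).  Supporting: `normalizer_PiXund_le_normalizer_PiCK` (`N(Π_{X̲_K}) ≤
N(Π_{C_K})`, so `n·embK g·n⁻¹ = embK g′` for SOME `g′ ∈ Π_C`: `exists_embK_eq_conj`), `mem_PiX_of_embK_eq_conj` (`g ∈ Π_X ⇒ g′ ∈ Π_X`,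
via `PiAvatarToFlStar.normalizer_PiXund_le_normalizer_PiXK`).
-/

noncomputable section

namespace Literature.IUT.HodgeTheaters

open scoped Pointwise

universe u v w

section CuspActionEquivariance

variable {F : Type u} {K : Type v} {Fbar : Type w} [Field F] [NumberField F] [Field K] [NumberField K]
  [Algebra F K] [Field Fbar] [Algebra F Fbar] [Algebra K Fbar]
  {E : WeierstrassCurve F} [E.IsElliptic] {l : ℕ} {Pb : BadPlacePredicates K}
  (D : InitialThetaData F K Fbar E l Pb) (CG : D.geom.pe.CuspGalois) (hS : D.CuspClassesNormaliserStable)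

namespace InitialThetaData

/-- If `φ(n)` normalises `S` then `n` normalises `φ⁻¹(S)` (plumbing). [folklore] -/
private theorem mem_normalizer_comap_of_map' {A' G' : Type*} [Group A'] [Group G'] (φ : A' →* G') (S : Subgroup G')
    {n : A'} (hn : φ n ∈ Subgroup.normalizer (S : Set G')) :
    n ∈ Subgroup.normalizer ((S.comap φ : Subgroup A') : Set A') := by
  rw [Subgroup.mem_normalizer_iff] at hn ⊢
  intro x
  rw [Subgroup.mem_comap, Subgroup.mem_comap, map_mul, map_mul, map_inv]
  exact hn (φ x)

/-- An element normalising `H` normalises `φ(H)` (plumbing). [folklore] -/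
private theorem map_mem_normalizer_map' {A' G' : Type*} [Group A'] [Group G'] (φ : A' →* G') (H : Subgroup A')
    {n : A'} (hn : n ∈ Subgroup.normalizer (H : Set A')) :
    φ n ∈ Subgroup.normalizer ((H.map φ : Subgroup G') : Set G') := by
  rw [Subgroup.mem_normalizer_iff] at hn ⊢
  intro y
  constructor
  · rintro ⟨x, hx, rfl⟩
    exact ⟨n * x * n⁻¹, (hn x).mp hx, by rw [map_mul, map_mul, map_inv]⟩
  · rintro ⟨x, hx, hxy⟩
    refine ⟨n⁻¹ * x * n, (hn (n⁻¹ * x * n)).mpr (by simpa [mul_assoc] using hx), ?_⟩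
    rw [map_mul, map_mul, map_inv, hxy]
    simp [mul_assoc]

/-- **`N(Π_{X̲_K}) ≤ N(Π_{C_K})`**: an element normalising `Π_{X̲_K}` normalises `augGF(Π_{X̲_K}) = G_K`, hence `Π_{C_K} = augGF⁻¹(G_K)`.
([IUTchI] Def 3.1 (d) p.62) [claim: Mochizuki2012, status: disputed] -/
theorem normalizer_PiXund_le_normalizer_PiCK :
    Subgroup.normalizer ((D.PiXund : Subgroup D.PiC) : Set D.PiC) ≤
      Subgroup.normalizer ((D.PiCK : Subgroup D.PiC) : Set D.PiC) := by
  intro n hn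
  rw [PiCK_eq_comap_augGF]
  apply mem_normalizer_comap_of_map'
  have h := map_mem_normalizer_map' D.augGF D.PiXund hn
  rw [map_augGF_PiXund] at h
  exact h

/-- For `n ∈ N(Π_{X̲_K})` and `g ∈ Π_C`: `n·embK g·n⁻¹ = embK g′` for some `g′ ∈ Π_C` (`Π_{C_K} = embK(Π_C)` is normalised by `n`).
([IUTchI] Def 3.1 (d) p.62) [claim: Mochizuki2012, status: disputed] -/
theorem exists_embK_eq_conj (n : ↥(Subgroup.normalizer ((D.PiXund : Subgroup D.PiC) : Set D.PiC))) (g : D.geom.pe.PiC) :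
    ∃ g' : D.geom.pe.PiC, D.geom.embK g' = (n : D.PiC) * D.geom.embK g * (n : D.PiC)⁻¹ := by
  have hn := D.normalizer_PiXund_le_normalizer_PiCK n.2
  rw [Subgroup.mem_normalizer_iff] at hn
  have hmem : (n : D.PiC) * D.geom.embK g * (n : D.PiC)⁻¹ ∈ D.PiCK :=
    (hn _).mp (by rw [InitialThetaData.PiCK]; exact ⟨g, rfl⟩)
  rw [InitialThetaData.PiCK] at hmem
  obtain ⟨g', hg'⟩ := hmem
  exact ⟨g', hg'⟩

/-- … and if `g ∈ Π_X` then `g′ ∈ Π_X` (`n` normalises `Π_{X_K} = embK(Π_X)`: `PiAvatarToFlStar`).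
([IUTchI] Def 3.1 (d) p.62) [claim: Mochizuki2012, status: disputed] -/
theorem mem_PiX_of_embK_eq_conj (n : ↥(Subgroup.normalizer ((D.PiXund : Subgroup D.PiC) : Set D.PiC)))
    {g g' : D.geom.pe.PiC} (hg : g ∈ D.geom.pe.PiX) (hg' : D.geom.embK g' = (n : D.PiC) * D.geom.embK g * (n : D.PiC)⁻¹) :
    g' ∈ D.geom.pe.PiX := by
  have hn := D.normalizer_PiXund_le_normalizer_PiXK n.2
  rw [Subgroup.mem_normalizer_iff] at hn
  have hmem : D.geom.embK g' ∈ D.PiXK := by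
    rw [hg']
    exact (hn _).mp (by rw [PiXK_eq_map]; exact Subgroup.mem_map_of_mem _ hg)
  rw [PiXK_eq_map] at hmem
  obtain ⟨g'', hg'', hEq⟩ := Subgroup.mem_map.mp hmem
  rwa [← D.geom.embK_injective hEq]

include CG in
/-- `Π_{X̲_K} ⊴ Π_{C_K}`: `embK c · u · (embK c)⁻¹ ∈ Π_{X̲_K}` for `u ∈ Π_{X̲_K}`, `c ∈ Π_C` (t1's `CuspGalois.normal_PiXbar`
along `embK`). ([IUTchI] §1 p.37) [claim: Mochizuki2012, status: disputed] -/
theorem conj_embK_mem_PiXund (c : D.geom.pe.PiC) {u : D.PiC} (hu : u ∈ D.PiXund) :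
    D.geom.embK c * u * (D.geom.embK c)⁻¹ ∈ D.PiXund := by
  obtain ⟨u', hu', rfl⟩ := Subgroup.mem_map.mp hu
  haveI := CG.normal_PiXbar
  rw [← map_mul, ← map_inv, ← map_mul]
  exact Subgroup.mem_map_of_mem _ (Subgroup.Normal.conj_mem inferInstance u' hu' c)

/-- **Equivariance `n·(g·x) = (n g n⁻¹)·(n·x)`.** ([IUTchI] Def 6.1 (v) p.158) [claim: Mochizuki2012, status: disputed] -/
theorem actF_act (n : ↥(Subgroup.normalizer ((D.PiXund : Subgroup D.PiC) : Set D.PiC))) (g g' : D.geom.pe.PiC)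
    (hg' : D.geom.embK g' = (n : D.PiC) * D.geom.embK g * (n : D.PiC)⁻¹) (x : D.geom.pe.Cusp) :
    D.actF CG hS n (CG.act g x) = CG.act g' (D.actF CG hS n x) := by
  -- the three conjugators
  obtain ⟨t₁, ht₁, h₁⟩ := D.actF_decomp CG hS n x
  obtain ⟨t, ht, h⟩ := CG.act_decomp g x
  obtain ⟨t₃, ht₃, h₃⟩ := CG.act_decomp g' (D.actF CG hS n x)
  -- `t₂ := embK t₃ · embK g′ · t₁ · n · (embK g)⁻¹ · (embK t)⁻¹ · n⁻¹ ∈ Π_{X̲_K}`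
  set t₂ : D.PiC := D.geom.embK t₃ * D.geom.embK g' * t₁ * (n : D.PiC) * (D.geom.embK g)⁻¹ * (D.geom.embK t)⁻¹ *
    (n : D.PiC)⁻¹ with ht₂def
  have hnorm : ∀ u ∈ D.PiXund, (n : D.PiC) * u * (n : D.PiC)⁻¹ ∈ D.PiXund :=
    fun u hu => (Subgroup.mem_normalizer_iff.mp n.2 u).mp hu
  have ht₂ : t₂ ∈ D.PiXund := by
    -- rewrite `t₂ = embK t₃ · (embK g′ · t₁ · (embK g′)⁻¹) · (n · (embK t)⁻¹ · n⁻¹)`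
    have key : t₂ = D.geom.embK t₃ * (D.geom.embK g' * t₁ * (D.geom.embK g')⁻¹) *
        ((n : D.PiC) * (D.geom.embK t)⁻¹ * (n : D.PiC)⁻¹) := by
      rw [ht₂def, hg']
      group
    rw [key]
    exact D.PiXund.mul_mem
      (D.PiXund.mul_mem (Subgroup.mem_map_of_mem _ ht₃) (D.conj_embK_mem_PiXund CG g' ht₁))
      (hnorm _ (D.PiXund.inv_mem (Subgroup.mem_map_of_mem _ ht)))
  refine D.actF_eq_of_conj CG hS n _ _ ht₂ ?_
  rw [← h, ← h₃, ← conj_embK_smul_map, ← conj_embK_smul_map, ← h₁, ← mul_smul, ← mul_smul, ← map_mul, ← map_mul]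
  congr 2
  rw [ht₂def, map_mul, map_mul]
  group

end InitialThetaData

end CuspActionEquivariance

end Literature.IUT.HodgeTheaters
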